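import Literature.Probability.Percolation.ZdFrontierFence
import Literature.Probability.Percolation.ZdFourArmOutLandedBarrier
import HarnessLib

/-!
# Protection rings around the tip: the closed-dual ring, and the two barrier lemmas

Topic `Literature/Probability/Percolation`; bond percolation on `ℤ² = Site 2` at `p = 1/2`.
DEFINITIONS with bodies (`dualTBFaceCrossing`, `dualRing`) and PROOFS (no named fact).  A brick
of the EXTERNAL per-scale lemma of Kesten's arm-separation theorem for four alternating arms of
bond percolation on `ℤ²`, cluster–frontier form (`ZdFrontierEvent.lean`, `ZdFrontierFence.lean`):
the PROTECTION rings of P. Nolin, EJP 13 (2008), §4.4, proof of Lemma 15 [arXiv 0711.4948: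
Lemma 14, p. 11] — "With probability at least `1-(1-δ'')^{-C''_4 log η}` we observe a white
circuit in one of the annuli in the first set, preventing other disjoint black crossings to
arrive near `z_u`, and also a black one in the second set, preventing white crossings to
arrive" — as events around a point `(M, t)` at scale `ρ`, and the two deterministic BARRIER
lemmas, which are colour-blind planar statements about an arbitrary configuration:

* `dualTBFaceCrossing u w h` (face-walk form of a closed-dual top–bottom crossing of the face box
  `u + [0,w] × [0,h]`, twin of the tree's `dualLRFaceCrossing`), its locality and RSW bound;
* `dualRing M t ρ` — closed-dual left–right crossings of the face strips above and below and
  closed-dual top–bottom crossings of the face strips left and right of the square of radius `ρ`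
  around `(M, t)` (Nolin's white circuit); `le_real_dualRing` (`≥ c⁴`, RSW ratio `4`, Harris for
  decreasing events), `determinedBy_dualRing` (read on the pairs of `ringSites M t ρ` of
  `ZdFrontierFence.lean`), whence `real_frontierEvent_inter_noDualRing_le`:
  `P(E_S ∩ ⋂_{k<K} (closedOn B_S (dualRing M t (r 4^k)))ᶜ) ≤ P(E_S) (1 - c⁴)^K`;
* `openRing_blocks_faceWalk` — **an open ring blocks dual paths**: if `ω ∈ openRing M t ρ`, no
  walk of faces crossing only `ω`-closed edges goes from a face inside the square of radius `ρ`
  to a face outside the square of radius `2ρ`;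
* `dualRing_blocks_walk` — **a closed-dual ring blocks open paths**: if `ω ∈ dualRing M t ρ`, no
  `ω`-open lattice walk goes from a vertex inside the square of radius `ρ` to a vertex outside
  the square of radius `2ρ`.

Both barriers are case analyses on the side of first exit, a segment lemma, and Bollobás–Riordan's
crossing lemma in a box (`exists_dart_sepEdge_mem_edges_lr_box`, `exists_dart_sepEdge_mem_edges_box`).

## References

* P. Nolin, *Near-critical percolation in two dimensions*, EJP 13 (2008), §4.4, proof of
  Lemma 15 (arXiv 0711.4948: Lemma 14, p. 11) [Nolin2008].
* H. Kesten, *Scaling relations for 2D-percolation*, CMP 109 (1987), §2, Lemma 4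
  [KestenScalingCMP1987].
* B. Bollobás, O. Riordan, *Percolation* (2006), Ch. 3, Lemma 1, Thm. 8 [BollobasRiordan2006].

## Tree

`dualLRFaceCrossing`, `dualLRFaceCrossingPairs`, `sepEdge_mem_dualLRFaceCrossingPairs`,
`le_real_dualLRFaceCrossing_of_rsw_ratio` (`ZdFourArmSepInwardExt.lean`); `openRing`, `ringSites`,
`mem_ringSites_iff` (`ZdFrontierFence.lean`); `closedOn`,
`real_frontierEvent_inter_biInter_compl_closedOn_le` (`ZdFrontierRings.lean`);
`exists_dart_sepEdge_mem_edges_lr_box` (`ZdFourArmOutLandedBarrier.lean`),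
`KSTPeriodic.exists_dart_sepEdge_mem_edges_box` (`KSTPeriodicArmDualityPlanar.lean`); `exists_prefix_exit`,
`exists_segment_between`, `forall_edges_mem_dualConfig_iff`, `bondPercolation_real_tbCrossingAt`,
`bondPercolation_map_dualConfig_holds`, `le_real_inter_of_lower`.
-/

noncomputable section

open SimpleGraph Finset

namespace Literature.Probability.Percolation

open LatticeModels _root_.MeasureTheory

variable {M N : ℕ} {ω : BondConfig (Site 2)} {S : Finset (Sym2 (Site 2))}

/-! ### The closed-dual top–bottom face crossing -/

/-- **A closed-dual top–bottom crossing of the translated face box** `u + ([0, w] × [0, h])`: a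
walk of faces (lower-left corners) inside the box from the face row `u₁` to the face row
`u₁ + h`, each step of which crosses a closed primal edge (twin of `dualLRFaceCrossing`). [folklore] -/
def dualTBFaceCrossing (u : Site 2) (w h : ℕ) : Set (BondConfig (Site 2)) :=
  {ω | ∃ (a b : Site 2) (W : (zdGraph 2).Walk a b), a 1 = u 1 ∧ b 1 = u 1 + h ∧
      (∀ f ∈ W.support, u 0 ≤ f 0 ∧ f 0 ≤ u 0 + w ∧ u 1 ≤ f 1 ∧ f 1 ≤ u 1 + h) ∧
      ∀ d ∈ W.darts, sepEdge d.fst d.snd ∉ ω}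

/-- The closed-dual top–bottom face crossing is decreasing. [folklore] -/
theorem isLowerSet_dualTBFaceCrossing (u : Site 2) (w h : ℕ) : IsLowerSet (dualTBFaceCrossing u w h) := by
  rintro ω ω' hle ⟨a, b, W, ha, hb, hs, hd⟩
  exact ⟨a, b, W, ha, hb, hs, fun d hd' he => hd d hd' (hle he)⟩

/-- `dualTBFaceCrossing u w h` is determined by the pairs of sites of `[u₀, u₀+w+1] × [u₁, u₁+h+1]`.
[folklore] -/
theorem determinedBy_dualTBFaceCrossing (u : Site 2) (w h : ℕ) :
    DeterminedBy (dualTBFaceCrossing u w h) ↑(dualLRFaceCrossingPairs u w h) := by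
  suffices key : ∀ ω ω' : BondConfig (Site 2),
      ω ∩ ↑(dualLRFaceCrossingPairs u w h) = ω' ∩ ↑(dualLRFaceCrossingPairs u w h) →
      ω' ∈ dualTBFaceCrossing u w h → ω ∈ dualTBFaceCrossing u w h by
    rw [determinedBy_iff]
    exact fun ω ω' hh => ⟨key ω' ω hh.symm, key ω ω' hh⟩
  rintro ω ω' hh ⟨a, b, W, ha, hb, hs, hd⟩
  refine ⟨a, b, W, ha, hb, hs, fun d hd' he => hd d hd' (mem_of_inter_eq hh ?_ he)⟩
  exact sepEdge_mem_dualLRFaceCrossingPairs (hs _ (W.dart_fst_mem_support_of_mem_darts hd'))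
    (hs _ (W.dart_snd_mem_support_of_mem_darts hd'))

/-- The closed-dual top–bottom face crossing event is measurable. [folklore] -/
theorem measurableSet_dualTBFaceCrossing (u : Site 2) (w h : ℕ) : MeasurableSet (dualTBFaceCrossing u w h) :=
  (determinedBy_dualTBFaceCrossing u w h).measurableSet_of_finset

/-- A top–bottom crossing of the translated rectangle by the DUAL configuration gives a face walk
of `dualTBFaceCrossing`. [folklore] -/
theorem preimage_dualConfig_tbCrossingAt'_subset (u : Site 2) (w h : ℕ) :
    dualConfig ⁻¹' tbCrossingAt' u w h ⊆ dualTBFaceCrossing u w h := by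
  intro ω hω
  obtain ⟨x, y, T, hx, hy, hT, hTe⟩ :=
    exists_walk_of_mem_tbCrossingAt (fun _ h => h.1 : dualConfig ω ⊆ (zdGraph 2).edgeSet) hω
  exact ⟨x, y, T, hx, hy, hT, (forall_edges_mem_dualConfig_iff T).1 hTe⟩

/-- **RSW input for the closed-dual top–bottom face crossing**: its probability at `p = 1/2` is at
least `crossingProb ½ h w`. [cite: BollobasRiordan2006, Ch. 3, Lemma 1 and Cor. 3(i)] -/
theorem crossingProb_le_real_dualTBFaceCrossing (u : Site 2) (w h : ℕ) :
    crossingProb half h w ≤ (bondPercolation (zdGraph 2) half).real (dualTBFaceCrossing u w h) := by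
  have h1 : (bondPercolation (zdGraph 2) half).real (dualConfig ⁻¹' tbCrossingAt' u w h) = crossingProb half h w := by
    rw [← map_measureReal_apply measurable_dualConfig (measurableSet_tbCrossingAt' u w h),
      bondPercolation_map_dualConfig_holds half, symm_half, tbCrossingAt', bondPercolation_real_tbCrossingAt]
  rw [← h1]
  exact measureReal_mono (preimage_dualConfig_tbCrossingAt'_subset u w h)

/-- RSW lower bound for a closed-dual top–bottom face crossing of aspect ratio at most `k`. [cite: BollobasRiordan2006, Ch. 3, eq. (3) and Cor. 3(i)] -/
theorem le_real_dualTBFaceCrossing_of_rsw_ratio {k : ℕ} {c : ℝ}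
    (hc : ∀ l : ℕ, 1 ≤ l → c ≤ crossingProb half (k * l - 1) (l - 1)) (u : Site 2) {w h : ℕ}
    (hh : h ≤ k * (w + 1) - 1) :
    c ≤ (bondPercolation (zdGraph 2) half).real (dualTBFaceCrossing u w h) := by
  refine le_trans ?_ (crossingProb_le_real_dualTBFaceCrossing u w h)
  have h' := hc (w + 1) (by omega)
  rw [Nat.add_sub_cancel] at h'
  exact h'.trans (crossingProb_anti_left half hh w)

/-! ### The closed-dual ring around `(M, t)` at scale `ρ` -/

/-- **The closed-dual ring at scale `ρ` around `(M, t)`** (Nolin's white circuit in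
`S_{ρ,2ρ}(z_u)`): closed-dual left–right crossings of the face strips
`[M-2ρ, M+2ρ-1] × [t+ρ, t+2ρ-1]` and `[M-2ρ, M+2ρ-1] × [t-2ρ, t-ρ-1]`, and closed-dual top–bottom
crossings of the face strips `[M-2ρ, M-ρ-1] × [t-2ρ, t+2ρ-1]` and `[M+ρ, M+2ρ-1] × [t-2ρ, t+2ρ-1]`.
[cite: Nolin2008, §4.4, proof of Lemma 15 (arXiv 0711.4948: Lemma 14, p. 11)] -/
def dualRing (M : ℕ) (t : ℤ) (ρ : ℕ) : Set (BondConfig (Site 2)) :=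
  dualLRFaceCrossing ![(M : ℤ) - 2 * ρ, t + ρ] (4 * ρ - 1) (ρ - 1) ∩
    (dualLRFaceCrossing ![(M : ℤ) - 2 * ρ, t - 2 * ρ] (4 * ρ - 1) (ρ - 1) ∩
      (dualTBFaceCrossing ![(M : ℤ) - 2 * ρ, t - 2 * ρ] (ρ - 1) (4 * ρ - 1) ∩
        dualTBFaceCrossing ![(M : ℤ) + ρ, t - 2 * ρ] (ρ - 1) (4 * ρ - 1)))

/-- The closed-dual ring is decreasing. [folklore] -/
theorem isLowerSet_dualRing (M : ℕ) (t : ℤ) (ρ : ℕ) : IsLowerSet (dualRing M t ρ) :=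
  (isLowerSet_dualLRFaceCrossing _ _ _).inter ((isLowerSet_dualLRFaceCrossing _ _ _).inter
    ((isLowerSet_dualTBFaceCrossing _ _ _).inter (isLowerSet_dualTBFaceCrossing _ _ _)))

/-- The closed-dual ring is measurable. [folklore] -/
theorem measurableSet_dualRing (M : ℕ) (t : ℤ) (ρ : ℕ) : MeasurableSet (dualRing M t ρ) :=
  (measurableSet_dualLRFaceCrossing _ _ _).inter ((measurableSet_dualLRFaceCrossing _ _ _).inter
    ((measurableSet_dualTBFaceCrossing _ _ _).inter (measurableSet_dualTBFaceCrossing _ _ _)))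

/-- A box of corner sites inside the ring region reads pairs of `ringSites`. [folklore] -/
theorem dualLRFaceCrossingPairs_subset_ringSites {t : ℤ} {ρ : ℕ} {u : Site 2} {w h : ℕ}
    (hu : ∀ z : Site 2, u 0 ≤ z 0 → z 0 ≤ u 0 + w + 1 → u 1 ≤ z 1 → z 1 ≤ u 1 + h + 1 → z ∈ ringSites M t ρ) :
    dualLRFaceCrossingPairs u w h ⊆ (ringSites M t ρ).sym2 := by
  refine Finset.sym2_mono fun z hz => ?_
  obtain ⟨h1, h2, h3, h4⟩ := mem_Icc_dualLRFace_iff.1 hz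
  exact hu z h1 h2 h3 h4

/-- **The closed-dual ring is read on the pairs of `ringSites`** (`ρ ≥ 1`). [folklore] -/
theorem determinedBy_dualRing (M : ℕ) (t : ℤ) {ρ : ℕ} (hρ : 1 ≤ ρ) :
    DeterminedBy (dualRing M t ρ) ↑((ringSites M t ρ).sym2) := by
  refine ((determinedBy_dualLRFaceCrossing _ _ _).mono (Finset.coe_subset.2
      (dualLRFaceCrossingPairs_subset_ringSites fun z h1 h2 h3 h4 => ?_))).inter
    (((determinedBy_dualLRFaceCrossing _ _ _).mono (Finset.coe_subset.2
      (dualLRFaceCrossingPairs_subset_ringSites fun z h1 h2 h3 h4 => ?_))).inter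
    (((determinedBy_dualTBFaceCrossing _ _ _).mono (Finset.coe_subset.2
      (dualLRFaceCrossingPairs_subset_ringSites fun z h1 h2 h3 h4 => ?_))).inter
    ((determinedBy_dualTBFaceCrossing _ _ _).mono (Finset.coe_subset.2
      (dualLRFaceCrossingPairs_subset_ringSites fun z h1 h2 h3 h4 => ?_)))))
  all_goals
    simp only [Matrix.cons_val_zero, Matrix.cons_val_one, Nat.cast_sub hρ,
      Nat.cast_sub (show 1 ≤ 4 * ρ by omega), Nat.cast_mul, Nat.cast_ofNat, Nat.cast_one] at h1 h2 h3 h4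
    rw [mem_ringSites_iff]
    omega

/-- **The closed-dual ring has probability at least `c⁴`**, `c` the RSW constant of ratio `4`
(Harris for decreasing events). [cite: BollobasRiordan2006, Ch. 3, Thm. 8 and Lemma 4] -/
theorem le_real_dualRing {c : ℝ} (hc0 : 0 ≤ c) (hc : ∀ l : ℕ, 1 ≤ l → c ≤ crossingProb half (4 * l - 1) (l - 1))
    (M : ℕ) (t : ℤ) {ρ : ℕ} (hρ : 1 ≤ ρ) : c ^ 4 ≤ (bondPercolation (zdGraph 2) half).real (dualRing M t ρ) := by
  have e : c ^ 4 = c * (c * (c * c)) := by ring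
  rw [e, dualRing]
  have h₁ := le_real_dualLRFaceCrossing_of_rsw_ratio hc ![(M : ℤ) - 2 * ρ, t + ρ] (M := 4 * ρ - 1) (h := ρ - 1) (by omega)
  have h₂ := le_real_dualLRFaceCrossing_of_rsw_ratio hc ![(M : ℤ) - 2 * ρ, t - 2 * ρ] (M := 4 * ρ - 1) (h := ρ - 1)
    (by omega)
  have h₃ := le_real_dualTBFaceCrossing_of_rsw_ratio hc ![(M : ℤ) - 2 * ρ, t - 2 * ρ] (w := ρ - 1) (h := 4 * ρ - 1)
    (by omega)
  have h₄ := le_real_dualTBFaceCrossing_of_rsw_ratio hc ![(M : ℤ) + ρ, t - 2 * ρ] (w := ρ - 1) (h := 4 * ρ - 1) (by omega)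
  have s₃ := le_real_inter_of_lower hc0 hc0 (isLowerSet_dualTBFaceCrossing _ _ _) (isLowerSet_dualTBFaceCrossing _ _ _)
    (measurableSet_dualTBFaceCrossing _ _ _) (measurableSet_dualTBFaceCrossing _ _ _) h₃ h₄
  have s₂ := le_real_inter_of_lower hc0 (by positivity) (isLowerSet_dualLRFaceCrossing _ _ _)
    ((isLowerSet_dualTBFaceCrossing _ _ _).inter (isLowerSet_dualTBFaceCrossing _ _ _))
    (measurableSet_dualLRFaceCrossing _ _ _)
    ((measurableSet_dualTBFaceCrossing _ _ _).inter (measurableSet_dualTBFaceCrossing _ _ _)) h₂ s₃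
  exact le_real_inter_of_lower hc0 (by positivity) (isLowerSet_dualLRFaceCrossing _ _ _)
    ((isLowerSet_dualLRFaceCrossing _ _ _).inter ((isLowerSet_dualTBFaceCrossing _ _ _).inter
      (isLowerSet_dualTBFaceCrossing _ _ _)))
    (measurableSet_dualLRFaceCrossing _ _ _)
    ((measurableSet_dualLRFaceCrossing _ _ _).inter ((measurableSet_dualTBFaceCrossing _ _ _).inter
      (measurableSet_dualTBFaceCrossing _ _ _)))
    h₁ s₂

/-- The RSW constant of ratio `4` (`rsw_lowerBound_holds`). [folklore] -/
theorem exists_rsw_four : ∃ c : ℝ, 0 < c ∧ ∀ l : ℕ, 1 ≤ l → c ≤ crossingProb half (4 * l - 1) (l - 1) :=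
  rsw_lowerBound_holds 4 (by norm_num)

/-- **No closed-dual ring at any of `K` scales costs `(1 - c⁴)^K` on the frontier event**:
`P_{1/2}(E_S ∩ ⋂_{k<K} (closedOn B_S (dualRing M t (r 4^k)))ᶜ) ≤ P_{1/2}(E_S) (1 - c⁴)^K`.
[cite: Nolin2008, §4.4, proof of Lemma 15 (arXiv 0711.4948: Lemma 14, p. 11)] -/
theorem real_frontierEvent_inter_noDualRing_le (hS : IsFrontierSet M N S) (hM : 1 ≤ M) {c : ℝ} (hc0 : 0 ≤ c)
    (hc : ∀ l : ℕ, 1 ≤ l → c ≤ crossingProb half (4 * l - 1) (l - 1)) (t : ℤ) {r : ℕ} (hr : 1 ≤ r) (K : ℕ) :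
    (bondPercolation (zdGraph 2) half).real
        (frontierEvent M N S ∩ ⋂ k ∈ Finset.range K, (closedOn (belowPairs M N S) (dualRing M t (r * 4 ^ k)))ᶜ) ≤
      (bondPercolation (zdGraph 2) half).real (frontierEvent M N S) * (1 - c ^ 4) ^ K :=
  have hrk : ∀ k, 1 ≤ r * 4 ^ k := fun k => Nat.le_mul_of_pos_right _ (by positivity) |>.trans' hr
  real_frontierEvent_inter_biInter_compl_closedOn_le half hS hM (fun k => dualRing M t (r * 4 ^ k))
    (fun k => (ringSites M t (r * 4 ^ k)).sym2) (fun _ => isLowerSet_dualRing _ _ _)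
    (fun k => determinedBy_dualRing _ _ (hrk k)) (fun _ _ hkl => disjoint_ringSites_sym2_pow hr hkl)
    fun k _ => le_real_dualRing hc0 hc M t (hrk k)

/-! ### Barrier 1: an open ring blocks dual paths -/

/-- Steps of a face walk whose darts cross closed edges cross closed edges in either direction.
[folklore] -/
theorem sepEdge_not_mem_of_mk_mem_edges {a b : Site 2} {δ : (zdGraph 2).Walk a b}
    (hδ : ∀ d ∈ δ.darts, sepEdge d.fst d.snd ∉ ω) {z z' : Site 2} (h : s(z, z') ∈ δ.edges) : sepEdge z z' ∉ ω := by
  rw [Walk.edges, List.mem_map] at h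
  obtain ⟨d, hd, hde⟩ := h
  have := hδ d hd
  rcases Sym2.eq_iff.1 (show s(d.fst, d.snd) = s(z, z') from hde) with ⟨h1, h2⟩ | ⟨h1, h2⟩
  · rwa [h1, h2] at this
  · rwa [h1, h2, sepEdge_comm] at this

/-- **An open ring blocks closed-dual paths.**  If `ω ∈ openRing M t ρ` (`ρ ≥ 1`, lattice `ω`),
there is no walk of faces whose steps all cross `ω`-closed edges from a face of the square
`[M-ρ, M+ρ-1] × [t-ρ, t+ρ-1]` (faces inside the square of radius `ρ` around `(M,t)`) to a face
outside `[M-2ρ, M+2ρ-1] × [t-2ρ, t+2ρ-1]`. [cite: BollobasRiordan2006, Ch. 3, Lemma 1] -/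
theorem openRing_blocks_faceWalk (hωE : ω ⊆ (zdGraph 2).edgeSet) {t : ℤ} {ρ : ℕ} (hρ : 1 ≤ ρ)
    (hring : ω ∈ openRing M t ρ) {f g : Site 2} (δ : (zdGraph 2).Walk f g)
    (hδ : ∀ d ∈ δ.darts, sepEdge d.fst d.snd ∉ ω)
    (hf : (M : ℤ) - ρ ≤ f 0 ∧ f 0 + 1 ≤ M + ρ ∧ t - ρ ≤ f 1 ∧ f 1 + 1 ≤ t + ρ)
    (hg : ¬ ((M : ℤ) - 2 * ρ ≤ g 0 ∧ g 0 + 1 ≤ M + 2 * ρ ∧ t - 2 * ρ ≤ g 1 ∧ g 1 + 1 ≤ t + 2 * ρ)) : False := by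
  classical
  obtain ⟨hHp, hHm, hVl, hVr⟩ := hring
  obtain ⟨xp, yp, Tp, hxp, hyp, hTps, hTpe⟩ := exists_walk_of_mem_lrCrossingAt hωE hHp
  obtain ⟨xm, ym, Tm, hxm, hym, hTms, hTme⟩ := exists_walk_of_mem_lrCrossingAt hωE hHm
  obtain ⟨xl, yl, Tl, hxl, hyl, hTls, hTle⟩ := exists_walk_of_mem_tbCrossingAt hωE hVl
  obtain ⟨xr, yr, Tr, hxr, hyr, hTrs, hTre⟩ := exists_walk_of_mem_tbCrossingAt hωE hVr
  simp only [Matrix.cons_val_zero, Matrix.cons_val_one, Nat.cast_mul, Nat.cast_ofNat] at hxp hyp hTps hxm hym hTms hxl hyl hTls hxr hyr hTrs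
  -- first exit of the face walk from the face box
  set A : Set (Site 2) := {h | (M : ℤ) - 2 * ρ ≤ h 0 ∧ h 0 + 1 ≤ M + 2 * ρ ∧ t - 2 * ρ ≤ h 1 ∧ h 1 + 1 ≤ t + 2 * ρ} with hA
  obtain ⟨x, y, δ₁, hxy, hy, hδ₁A, hδ₁S, hδ₁E, hlast⟩ := exists_prefix_exit (A := A) δ (by simp only [hA, Set.mem_setOf_eq]; omega) hg
  have hx : x ∈ A := hδ₁A x δ₁.end_mem_support
  simp only [hA, Set.mem_setOf_eq] at hx hy hδ₁A
  -- the prefix followed by the exit step, and its closed steps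
  set δ₂ := δ₁.concat hxy with hδ₂
  have hδ₂e : ∀ e ∈ δ₂.edges, e ∈ δ.edges := by
    intro e he
    rw [hδ₂, Walk.edges_concat, List.concat_eq_append, List.mem_append, List.mem_singleton] at he
    rcases he with he | rfl
    · exact hδ₁E e he
    · exact hlast
  have hδ₂s : ∀ z ∈ δ₂.support, z ∈ δ₁.support ∨ z = y := by
    intro z hz
    rw [hδ₂, Walk.support_concat, List.mem_append, List.mem_singleton] at hz
    exact hz
  have hclosed : ∀ {p q : Site 2} (U : (zdGraph 2).Walk p q), (∀ e ∈ U.edges, e ∈ δ₂.edges) →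
      ∀ d ∈ U.darts, sepEdge d.fst d.snd ∉ ω := fun U hU d hd =>
    sepEdge_not_mem_of_mk_mem_edges hδ (hδ₂e _ (hU _ (by rw [Walk.edges]; exact List.mem_map.2 ⟨d, hd, rfl⟩)))
  have hstep := zdGraph_adj_apply_le hxy
  have h0 := hstep 0
  have h1 := hstep 1
  -- which side?
  by_cases htop : y 1 + 1 > t + 2 * ρ
  · -- exit through the top: cross `H⁺`
    have hy1 : y 1 = t + 2 * ρ := by omega
    have hy0 : y 0 = x 0 := by
      rcases stepKind_of_adj hxy with ⟨h0', h1'⟩ | ⟨h0', h1'⟩ | ⟨h1', h0'⟩ | ⟨h1', h0'⟩ <;> omega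
    obtain ⟨p, q, U, hp, hq, hUs, hUe⟩ := exists_segment_between 1 δ₂ (t + ρ - 1) (t + 2 * ρ) (by omega) (by
      show t + 2 * ρ ≤ y 1; omega) (by omega)
    obtain ⟨dq, hdq, hsep⟩ := exists_dart_sepEdge_mem_edges_lr_box (L := (M : ℤ) - 2 * ρ) (R := (M : ℤ) + 2 * ρ)
      (B := t + ρ) (T := t + 2 * ρ) Tp U.reverse (fun z hz => by have := hTps z hz; omega)
      (fun z hz => by
        rw [Walk.support_reverse, List.mem_reverse] at hz
        have h3 := hUs z hz
        rcases hδ₂s z h3.2.2 with h4 | rfl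
        · have := hδ₁A z h4; omega
        · omega)
      hxp (by omega) hq (by omega)
    refine hclosed U.reverse (fun e he => hUe e (by rwa [Walk.edges_reverse, List.mem_reverse] at he)) dq hdq ?_
    exact hTpe _ hsep
  by_cases hbot : t - 2 * ρ > y 1
  · -- exit through the bottom: cross `H⁻`
    have hy1 : y 1 = t - 2 * ρ - 1 := by omega
    have hy0 : y 0 = x 0 := by
      rcases stepKind_of_adj hxy with ⟨h0', h1'⟩ | ⟨h0', h1'⟩ | ⟨h1', h0'⟩ | ⟨h1', h0'⟩ <;> omega
    obtain ⟨p, q, U, hp, hq, hUs, hUe⟩ := exists_segment_between 1 δ₂.reverse (t - 2 * ρ - 1) (t - ρ) (by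
      show y 1 ≤ t - 2 * ρ - 1; omega) (by omega) (by omega)
    obtain ⟨dq, hdq, hsep⟩ := exists_dart_sepEdge_mem_edges_lr_box (L := (M : ℤ) - 2 * ρ) (R := (M : ℤ) + 2 * ρ)
      (B := t - 2 * ρ) (T := t - ρ) Tm U.reverse (fun z hz => by have := hTms z hz; omega)
      (fun z hz => by
        rw [Walk.support_reverse, List.mem_reverse] at hz
        have h3 := hUs z hz
        have h5 : z ∈ δ₂.support := by have := h3.2.2; rwa [Walk.support_reverse, List.mem_reverse] at this
        rcases hδ₂s z h5 with h4 | rfl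
        · have := hδ₁A z h4; omega
        · omega)
      hxm (by omega) hq (by omega)
    refine hclosed U.reverse (fun e he => ?_) dq hdq (hTme _ hsep)
    have := hUe e (by rwa [Walk.edges_reverse, List.mem_reverse] at he)
    rwa [Walk.edges_reverse, List.mem_reverse] at this
  by_cases hright : y 0 + 1 > (M : ℤ) + 2 * ρ
  · -- exit through the right: cross `V^R`
    have hy0 : y 0 = M + 2 * ρ := by omega
    have hy1 : y 1 = x 1 := by
      rcases stepKind_of_adj hxy with ⟨h0', h1'⟩ | ⟨h0', h1'⟩ | ⟨h1', h0'⟩ | ⟨h1', h0'⟩ <;> omega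
    obtain ⟨p, q, U, hp, hq, hUs, hUe⟩ := exists_segment_between 0 δ₂ ((M : ℤ) + ρ - 1) ((M : ℤ) + 2 * ρ) (by omega) (by
      show (M : ℤ) + 2 * ρ ≤ y 0; omega) (by omega)
    obtain ⟨dq, hdq, hsep⟩ := KSTPeriodic.exists_dart_sepEdge_mem_edges_box (L := (M : ℤ) + ρ) (R := (M : ℤ) + 2 * ρ)
      (B := t - 3 * ρ) (T := t + 3 * ρ) Tr U.reverse (fun z hz => by have := hTrs z hz; omega)
      (fun z hz => by
        rw [Walk.support_reverse, List.mem_reverse] at hz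
        have h3 := hUs z hz
        rcases hδ₂s z h3.2.2 with h4 | rfl
        · have := hδ₁A z h4; omega
        · omega)
      hxr (by omega) hq (by omega)
    refine hclosed U.reverse (fun e he => hUe e (by rwa [Walk.edges_reverse, List.mem_reverse] at he)) dq hdq ?_
    exact hTre _ hsep
  -- exit through the left: cross `V^L`
  have hy0 : y 0 = (M : ℤ) - 2 * ρ - 1 := by omega
  have hy1 : y 1 = x 1 := by
    rcases stepKind_of_adj hxy with ⟨h0', h1'⟩ | ⟨h0', h1'⟩ | ⟨h1', h0'⟩ | ⟨h1', h0'⟩ <;> omega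
  obtain ⟨p, q, U, hp, hq, hUs, hUe⟩ := exists_segment_between 0 δ₂.reverse ((M : ℤ) - 2 * ρ - 1) ((M : ℤ) - ρ) (by
    show y 0 ≤ (M : ℤ) - 2 * ρ - 1; omega) (by omega) (by omega)
  obtain ⟨dq, hdq, hsep⟩ := KSTPeriodic.exists_dart_sepEdge_mem_edges_box (L := (M : ℤ) - 2 * ρ) (R := (M : ℤ) - ρ)
    (B := t - 2 * ρ) (T := t + 2 * ρ) Tl U.reverse (fun z hz => by have := hTls z hz; omega)
    (fun z hz => by
      rw [Walk.support_reverse, List.mem_reverse] at hz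
      have h3 := hUs z hz
      have h5 : z ∈ δ₂.support := by have := h3.2.2; rwa [Walk.support_reverse, List.mem_reverse] at this
      rcases hδ₂s z h5 with h4 | rfl
      · have := hδ₁A z h4; omega
      · omega)
    hxl (by omega) hq (by omega)
  refine hclosed U.reverse (fun e he => ?_) dq hdq (hTle _ hsep)
  have := hUe e (by rwa [Walk.edges_reverse, List.mem_reverse] at he)
  rwa [Walk.edges_reverse, List.mem_reverse] at this

/-! ### Barrier 2: a closed-dual ring blocks open paths -/

/-- **A closed-dual ring blocks open paths.**  If `ω ∈ dualRing M t ρ` (`ρ ≥ 1`), there is no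
`ω`-open lattice walk from a vertex of the square `[M-ρ, M+ρ] × [t-ρ, t+ρ]` to a vertex outside
the open square `(M-2ρ, M+2ρ) × (t-2ρ, t+2ρ)`. [cite: BollobasRiordan2006, Ch. 3, Lemma 1] -/
theorem dualRing_blocks_walk {t : ℤ} {ρ : ℕ} (hρ : 1 ≤ ρ) (hring : ω ∈ dualRing M t ρ)
    {p q : Site 2} (π : (zdGraph 2).Walk p q) (hπ : ∀ e ∈ π.edges, e ∈ ω)
    (hp : (M : ℤ) - ρ ≤ p 0 ∧ p 0 ≤ M + ρ ∧ t - ρ ≤ p 1 ∧ p 1 ≤ t + ρ)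
    (hq : ¬ ((M : ℤ) - 2 * ρ + 1 ≤ q 0 ∧ q 0 + 1 ≤ M + 2 * ρ ∧ t - 2 * ρ + 1 ≤ q 1 ∧ q 1 + 1 ≤ t + 2 * ρ)) :
    False := by
  classical
  have h14 : 1 ≤ 4 * ρ := by omega
  obtain ⟨hHp, hHm, hVl, hVr⟩ := hring
  obtain ⟨ap, bp, Wp, hap, hbp, hWps, hWpd⟩ := hHp
  obtain ⟨am, bm, Wm, ham, hbm, hWms, hWmd⟩ := hHm
  obtain ⟨al, bl, Wl, hal, hbl, hWls, hWld⟩ := hVl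
  obtain ⟨ar, br, Wr, har, hbr, hWrs, hWrd⟩ := hVr
  simp only [Matrix.cons_val_zero, Matrix.cons_val_one, Nat.cast_mul, Nat.cast_ofNat, Nat.cast_sub hρ,
    Nat.cast_sub h14, Nat.cast_one] at hap hbp hWps ham hbm hWms hal hbl hWls har hbr hWrs
  -- first exit of the open walk from the open square
  set A : Set (Site 2) :=
    {v | (M : ℤ) - 2 * ρ + 1 ≤ v 0 ∧ v 0 + 1 ≤ M + 2 * ρ ∧ t - 2 * ρ + 1 ≤ v 1 ∧ v 1 + 1 ≤ t + 2 * ρ} with hA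
  obtain ⟨x, y, π₁, hxy, hy, hπ₁A, hπ₁S, hπ₁E, hlast⟩ :=
    exists_prefix_exit (A := A) π (by simp only [hA, Set.mem_setOf_eq]; omega) hq
  have hx : x ∈ A := hπ₁A x π₁.end_mem_support
  simp only [hA, Set.mem_setOf_eq] at hx hy hπ₁A
  set π₂ := π₁.concat hxy with hπ₂
  have hπ₂e : ∀ e ∈ π₂.edges, e ∈ ω := by
    intro e he
    rw [hπ₂, Walk.edges_concat, List.concat_eq_append, List.mem_append, List.mem_singleton] at he
    rcases he with he | rfl
    · exact hπ e (hπ₁E e he)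
    · exact hπ _ hlast
  have hπ₂s : ∀ z ∈ π₂.support, z ∈ π₁.support ∨ z = y := by
    intro z hz
    rw [hπ₂, Walk.support_concat, List.mem_append, List.mem_singleton] at hz
    exact hz
  have hstep := zdGraph_adj_apply_le hxy
  have h0 := hstep 0
  have h1 := hstep 1
  -- a dart of a reversed face walk crosses a closed edge
  have hrev : ∀ {a b : Site 2} {W : (zdGraph 2).Walk a b}, (∀ d ∈ W.darts, sepEdge d.fst d.snd ∉ ω) →
      ∀ d ∈ W.reverse.darts, sepEdge d.fst d.snd ∉ ω := fun {a b W} hW d hd =>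
    sepEdge_not_mem_of_mk_mem_edges hW (by
      have : s(d.fst, d.snd) ∈ W.reverse.edges := by rw [Walk.edges]; exact List.mem_map.2 ⟨d, hd, rfl⟩
      rwa [Walk.edges_reverse, List.mem_reverse] at this)
  by_cases htop : y 1 + 1 > t + 2 * ρ
  · -- exit through the top: cross the closed-dual `H*⁺`
    have hy1 : y 1 = t + 2 * ρ := by omega
    have hy0 : y 0 = x 0 := by
      rcases stepKind_of_adj hxy with ⟨h0', h1'⟩ | ⟨h0', h1'⟩ | ⟨h1', h0'⟩ | ⟨h1', h0'⟩ <;> omega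
    obtain ⟨p', q', U, hp', hq', hUs, hUe⟩ := exists_segment_between 1 π₂ (t + ρ) (t + 2 * ρ) (by omega)
      (by show t + 2 * ρ ≤ y 1; omega) (by omega)
    obtain ⟨dq, hdq, hsep⟩ := KSTPeriodic.exists_dart_sepEdge_mem_edges_box (L := (M : ℤ) - 2 * ρ + 1)
      (R := (M : ℤ) + 2 * ρ - 1) (B := t + ρ) (T := t + 2 * ρ) U Wp.reverse
      (fun z hz => by
        have h3 := hUs z hz
        rcases hπ₂s z h3.2.2 with h4 | rfl
        · have := hπ₁A z h4; omega
        · omega)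
      (fun z hz => by
        rw [Walk.support_reverse, List.mem_reverse] at hz
        have := hWps z hz; omega)
      hp' hq' (by omega) (by omega)
    exact hrev hWpd dq hdq (hπ₂e _ (hUe _ hsep))
  by_cases hbot : t - 2 * ρ + 1 > y 1
  · -- exit through the bottom: cross `H*⁻`
    have hy1 : y 1 = t - 2 * ρ := by omega
    have hy0 : y 0 = x 0 := by
      rcases stepKind_of_adj hxy with ⟨h0', h1'⟩ | ⟨h0', h1'⟩ | ⟨h1', h0'⟩ | ⟨h1', h0'⟩ <;> omega
    obtain ⟨p', q', U, hp', hq', hUs, hUe⟩ := exists_segment_between 1 π₂.reverse (t - 2 * ρ) (t - ρ)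
      (by show y 1 ≤ t - 2 * ρ; omega) (by omega) (by omega)
    obtain ⟨dq, hdq, hsep⟩ := KSTPeriodic.exists_dart_sepEdge_mem_edges_box (L := (M : ℤ) - 2 * ρ + 1)
      (R := (M : ℤ) + 2 * ρ - 1) (B := t - 2 * ρ) (T := t - ρ) U Wm.reverse
      (fun z hz => by
        have h3 := hUs z hz
        have h5 : z ∈ π₂.support := by have := h3.2.2; rwa [Walk.support_reverse, List.mem_reverse] at this
        rcases hπ₂s z h5 with h4 | rfl
        · have := hπ₁A z h4; omega
        · omega)
      (fun z hz => by
        rw [Walk.support_reverse, List.mem_reverse] at hz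
        have := hWms z hz; omega)
      hp' hq' (by omega) (by omega)
    refine hrev hWmd dq hdq (hπ₂e _ ?_)
    have := hUe _ hsep
    rwa [Walk.edges_reverse, List.mem_reverse] at this
  by_cases hright : y 0 + 1 > (M : ℤ) + 2 * ρ
  · -- exit through the right: cross `V*ᴿ`
    have hy0 : y 0 = M + 2 * ρ := by omega
    have hy1 : y 1 = x 1 := by
      rcases stepKind_of_adj hxy with ⟨h0', h1'⟩ | ⟨h0', h1'⟩ | ⟨h1', h0'⟩ | ⟨h1', h0'⟩ <;> omega
    obtain ⟨p', q', U, hp', hq', hUs, hUe⟩ := exists_segment_between 0 π₂ ((M : ℤ) + ρ) ((M : ℤ) + 2 * ρ) (by omega)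
      (by show (M : ℤ) + 2 * ρ ≤ y 0; omega) (by omega)
    obtain ⟨dq, hdq, hsep⟩ := exists_dart_sepEdge_mem_edges_lr_box (L := (M : ℤ) + ρ) (R := (M : ℤ) + 2 * ρ)
      (B := t - 2 * ρ + 1) (T := t + 2 * ρ - 1) U Wr.reverse
      (fun z hz => by
        have h3 := hUs z hz
        rcases hπ₂s z h3.2.2 with h4 | rfl
        · have := hπ₁A z h4; omega
        · omega)
      (fun z hz => by
        rw [Walk.support_reverse, List.mem_reverse] at hz
        have := hWrs z hz; omega)
      hp' hq' (by omega) (by omega)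
    exact hrev hWrd dq hdq (hπ₂e _ (hUe _ hsep))
  -- exit through the left: cross `V*ᴸ`
  have hy0 : y 0 = (M : ℤ) - 2 * ρ := by omega
  have hy1 : y 1 = x 1 := by
    rcases stepKind_of_adj hxy with ⟨h0', h1'⟩ | ⟨h0', h1'⟩ | ⟨h1', h0'⟩ | ⟨h1', h0'⟩ <;> omega
  obtain ⟨p', q', U, hp', hq', hUs, hUe⟩ := exists_segment_between 0 π₂.reverse ((M : ℤ) - 2 * ρ) ((M : ℤ) - ρ)
    (by show y 0 ≤ (M : ℤ) - 2 * ρ; omega) (by omega) (by omega)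
  obtain ⟨dq, hdq, hsep⟩ := exists_dart_sepEdge_mem_edges_lr_box (L := (M : ℤ) - 2 * ρ) (R := (M : ℤ) - ρ)
    (B := t - 2 * ρ + 1) (T := t + 2 * ρ - 1) U Wl.reverse
    (fun z hz => by
      have h3 := hUs z hz
      have h5 : z ∈ π₂.support := by have := h3.2.2; rwa [Walk.support_reverse, List.mem_reverse] at this
      rcases hπ₂s z h5 with h4 | rfl
      · have := hπ₁A z h4; omega
      · omega)
    (fun z hz => by
      rw [Walk.support_reverse, List.mem_reverse] at hz
      have := hWls z hz; omega)
    hp' hq' (by omega) (by omega)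
  refine hrev hWld dq hdq (hπ₂e _ ?_)
  have := hUe _ hsep
  rwa [Walk.edges_reverse, List.mem_reverse] at this

end Literature.Probability.Percolation

end
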